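import Mathlib

/-!
# `Balaban1983to89.B16Eq112` — (1.12) and (1.13) of T. Bałaban, *Large field renormalization. II. Localization,
exponentiation, and bounds for the 𝐑 operation*, Commun. Math. Phys. **122**, 355–392 (1989) [Balaban1989LargeFieldII],
p. 359: the criticality equation of the variational problem of Proposition 1 [IV] and its fixed-point form — TYPED over
real inner-product spaces and the rewriting (1.12) ⇔ (1.13) PROVED

statement-level skeleton of published theorems with citation tags; proofs where landed; nothing here is a claim about
the Yang–Mills mass gap

PDF held: `paper:balaban1989-cmp122-large-field-ii` (journal page = PDF page + 354); [IV] = [Balaban1989LargeFieldI],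
[15] = [Balaban1985Variational].  The quotations below were READ AS AN IMAGE by this seat on the x4 render
`run/shared/lean/pub/pub-balaban/b2b-balaban-ref1/pages/1989-cmp122-large-field-II/…-p005-x4.png` (p. 359).

CITATION HEADER / WHAT IS REPRODUCED (mega-formalization `lit-balaban`, reader/typer r13 gen 3; HOME
`run/shared/lean/pub/lit-balaban/`, rows `lit-balaban-r13/ROWS-B16.md`): SKELETON rows **B16.Eq1.12** (`absent` at
SKELETON v3.12; NE-cited locus F-T4-164) and **B16.Eq1.13** (display absent; its contraction consequence *"exactly one
solution, which has a bound equal to twice a bound of the right-hand side"* is the kernel theorem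
`…B16Sect1Kernels.fixedPoint_twice_bound`, p238958).  p. 359 [PDF 5], verbatim: *"Now we prove Proposition 1 [IV]. …
we consider the variational problem for the function V′↾_Λ → A(U_{k,Z}(V′V_k)), where V′ satisfies mild regularity
conditions. Fixing the gauge G₀ for V′ we get a small configuration, and we can write V′ = exp iB′. We expand the
function with respect to B′, the expansion has the same form as in the exponentials in (5.2), but without the powers of
g_k, and with ζ₀ = 1. Now the condition for a critical configuration is the equation
⟨δB′, H*_{1,k}J_{k,Z}⟩ + ⟨δB′, H*_{1,k}Δ₁H_{1,k}B′⟩ + ⟨δB′, H*_{1,k}((δ/δA)V)(H_{1,k}B′)⟩ = 0. (1.12)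
Denote by P₀ the projection onto the subspace of B′ satisfying the gauge condition B′↾_{G₀} = 0. By the inequality (1.9)
the operator P₀H*_{1,k}Δ₁H_{1,k}P₀ is positive, hence invertible on this subspace, and the inverse is bounded by
γ₀⁻¹2d(100M)⁵. Equation (1.12) can be written as
B′ + (P₀H*_{1,k}Δ₁H_{1,k}P₀)⁻¹P₀H*_{1,k}((δ/δA)V)(H_{1,k}B′) = −(P₀H*_{1,k}Δ₁H_{1,k}P₀)⁻¹P₀H*_{1,k}J_{k,Z}. (1.13)"*
("(5.2)" = (1.2), cell slip D-b02.1.)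

CARRIERS (ref-1 F6; no new structure, no `def`).  `E` = the real inner-product space of (𝔤-valued) fields `B′` on the
bonds of `Λ` (inner product `⟨·,·⟩` of the display), `F` = the space of vector fields `A` on `T_η`; `H : E →ₗ F` =
`H_{1,k}`, `Hst : F →ₗ E` = `H*_{1,k}` (its printed adjoint; adjointness is not needed for the rewriting and is not
assumed), `Δ₁ : F →ₗ F`, `dV : F → F` = the (nonlinear) map `A ↦ ((δ/δA)V)(A)`, `J : F` = `J_{k,Z}`, `P₀ : E →ₗ E` = the
orthogonal projection of the gauge condition (`hP2 : P₀P₀ = P₀`, `hPsa` self-adjointness), `K = P₀H*Δ₁HP₀` and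
`Kinv : E →ₗ E` = its inverse ON THE SUBSPACE `P₀E` extended by `Kinv = KinvP₀` (hypotheses `hKl : Kinv K = P₀`,
`hKr : K Kinv = P₀` — the printed *"invertible on this subspace"*; its bound `γ₀⁻¹2d(100M)⁵` is row B16.Eq1.9 /
`…B16Sect1Kernels`, not used).  (1.12) is read as the condition for ALL variations `δB′` in the gauge (`P₀δB′ = δB′`)
at a configuration `B′` in the gauge (`P₀B′ = B′`).  Every declaration is a theorem proved from its displayed hypotheses;
nothing printed is asserted as a fact.
-/

namespace Literature.MathematicalPhysics.QuantumFieldTheory.Balaban1983to89.B16Eq112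

open scoped RealInnerProductSpace

variable {E F : Type*} [NormedAddCommGroup E] [InnerProductSpace ℝ E] [NormedAddCommGroup F] [InnerProductSpace ℝ F]

/-- In a gauge subspace `P₀E` (orthogonal projection `P₀`): a vector `X` is orthogonal to every variation in the gauge,
`⟨δB′, X⟩ = 0` for all `δB′ = P₀δB′`, iff `P₀X = 0` — the step from the variational form (1.12) to the operator form
behind (1.13). [cite: Balaban1989LargeFieldII, (1.12) p.359] -/
theorem forall_gauge_inner_eq_zero_iff {P₀ : E →ₗ[ℝ] E} (hP2 : ∀ x, P₀ (P₀ x) = P₀ x)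
    (hPsa : ∀ x y, ⟪P₀ x, y⟫ = ⟪x, P₀ y⟫) (X : E) :
    (∀ δB : E, P₀ δB = δB → ⟪δB, X⟫ = 0) ↔ P₀ X = 0 := by
  constructor
  · intro h
    refine ext_inner_left ℝ fun w => ?_
    rw [inner_zero_right, ← hPsa]
    exact h (P₀ w) (hP2 w)
  · intro h δB hδ
    rw [← hδ, hPsa, h, inner_zero_right]

/-- **(1.12)** p. 359 [PDF 5], verbatim: *"Now the condition for a critical configuration is the equation
⟨δB′, H*_{1,k}J_{k,Z}⟩ + ⟨δB′, H*_{1,k}Δ₁H_{1,k}B′⟩ + ⟨δB′, H*_{1,k}((δ/δA)V)(H_{1,k}B′)⟩ = 0. (1.12)"* — in OPERATOR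
form: for `B′` and all variations in the gauge `P₀`, (1.12) holds iff
`P₀(H*J_{k,Z} + H*Δ₁H B′ + H*((δ/δA)V)(HB′)) = 0`. [cite: Balaban1989LargeFieldII, (1.12) p.359] -/
theorem eq112_iff_proj_eq_zero {P₀ : E →ₗ[ℝ] E} (hP2 : ∀ x, P₀ (P₀ x) = P₀ x)
    (hPsa : ∀ x y, ⟪P₀ x, y⟫ = ⟪x, P₀ y⟫) (H : E →ₗ[ℝ] F) (Hst : F →ₗ[ℝ] E) (Δ₁ : F →ₗ[ℝ] F) (dV : F → F)
    (J : F) (B : E) :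
    (∀ δB : E, P₀ δB = δB → ⟪δB, Hst J⟫ + ⟪δB, Hst (Δ₁ (H B))⟫ + ⟪δB, Hst (dV (H B))⟫ = 0) ↔
      P₀ (Hst J + Hst (Δ₁ (H B)) + Hst (dV (H B))) = 0 := by
  rw [← forall_gauge_inner_eq_zero_iff hP2 hPsa]
  refine forall₂_congr fun δB _ => ?_
  rw [inner_add_right, inner_add_right]

/-- **(1.13)** p. 359 [PDF 5], verbatim: *"Denote by P₀ the projection onto the subspace of B′ satisfying the gauge
condition B′↾_{G₀} = 0. By the inequality (1.9) the operator P₀H*_{1,k}Δ₁H_{1,k}P₀ is positive, hence invertible on this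
subspace, and the inverse is bounded by γ₀⁻¹2d(100M)⁵. Equation (1.12) can be written as
B′ + (P₀H*_{1,k}Δ₁H_{1,k}P₀)⁻¹P₀H*_{1,k}((δ/δA)V)(H_{1,k}B′) = −(P₀H*_{1,k}Δ₁H_{1,k}P₀)⁻¹P₀H*_{1,k}J_{k,Z}. (1.13)"* — PROVED:
for `B′` in the gauge (`P₀B′ = B′`), with `K = P₀H*Δ₁HP₀` inverted on the subspace by `Kinv` (`KinvK = P₀`, `KKinv = P₀`,
`Kinv = KinvP₀`), the variational equation (1.12) (all variations `δB′` in the gauge) is EQUIVALENT to the fixed-point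
equation (1.13). [cite: Balaban1989LargeFieldII, (1.13) p.359] -/
theorem eq112_iff_eq113 {P₀ : E →ₗ[ℝ] E} (hP2 : ∀ x, P₀ (P₀ x) = P₀ x) (hPsa : ∀ x y, ⟪P₀ x, y⟫ = ⟪x, P₀ y⟫)
    (H : E →ₗ[ℝ] F) (Hst : F →ₗ[ℝ] E) (Δ₁ : F →ₗ[ℝ] F) (dV : F → F) (J : F) {Kinv : E →ₗ[ℝ] E}
    (hKl : ∀ x, Kinv (P₀ (Hst (Δ₁ (H (P₀ x))))) = P₀ x) (hKr : ∀ x, P₀ (Hst (Δ₁ (H (P₀ (Kinv x))))) = P₀ x)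
    (hKP : ∀ x, Kinv (P₀ x) = Kinv x) {B : E} (hB : P₀ B = B) :
    (∀ δB : E, P₀ δB = δB → ⟪δB, Hst J⟫ + ⟪δB, Hst (Δ₁ (H B))⟫ + ⟪δB, Hst (dV (H B))⟫ = 0) ↔
      B + Kinv (P₀ (Hst (dV (H B)))) = -Kinv (P₀ (Hst J)) := by
  rw [eq112_iff_proj_eq_zero hP2 hPsa]
  have hKB : Kinv (P₀ (Hst (Δ₁ (H B)))) = B := by
    have h := hKl B
    rwa [hB] at h
  constructor
  · -- apply `Kinv` to `P₀(H*J + H*Δ₁HB′ + H*dV(HB′)) = 0`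
    intro h
    have h' := congrArg Kinv h
    rw [map_zero, map_add P₀, map_add P₀, map_add Kinv, map_add Kinv, hKB] at h'
    -- h' : Kinv (P₀ (Hst J)) + B + Kinv (P₀ (Hst (dV (H B)))) = 0
    rw [eq_neg_iff_add_eq_zero, ← h']
    abel
  · -- apply `K = P₀H*Δ₁HP₀` to (1.13)
    intro h
    have hKr' : ∀ x, P₀ (Hst (Δ₁ (H (P₀ (Kinv (P₀ x)))))) = P₀ x := fun x => by rw [hKP, hKr]
    have h' := congrArg (fun y => P₀ (Hst (Δ₁ (H (P₀ y))))) h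
    simp only [map_add, map_neg, hKr', hB] at h'
    -- h' : P₀ (Hst (Δ₁ (H B))) + P₀ (Hst (dV (H B))) = -P₀ (Hst J)
    rw [map_add, map_add, add_assoc, h', add_neg_cancel]

/-- The right-to-left reading in words: a solution of the fixed-point equation (1.13) lying in the gauge subspace is a
critical configuration in the sense of (1.12) (used together with the contraction argument *"Using Proposition 4 [15]
and the fixed point theorem for contractive mappings, we can easily prove that the above equation has exactly one
solution"*, whose quantitative half is `…B16Sect1Kernels.fixedPoint_twice_bound`). [cite: Balaban1989LargeFieldII, (1.13) p.359] -/
theorem eq112_of_eq113 {P₀ : E →ₗ[ℝ] E} (hP2 : ∀ x, P₀ (P₀ x) = P₀ x) (hPsa : ∀ x y, ⟪P₀ x, y⟫ = ⟪x, P₀ y⟫)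
    (H : E →ₗ[ℝ] F) (Hst : F →ₗ[ℝ] E) (Δ₁ : F →ₗ[ℝ] F) (dV : F → F) (J : F) {Kinv : E →ₗ[ℝ] E}
    (hKl : ∀ x, Kinv (P₀ (Hst (Δ₁ (H (P₀ x))))) = P₀ x) (hKr : ∀ x, P₀ (Hst (Δ₁ (H (P₀ (Kinv x))))) = P₀ x)
    (hKP : ∀ x, Kinv (P₀ x) = Kinv x) {B : E} (hB : P₀ B = B)
    (h113 : B + Kinv (P₀ (Hst (dV (H B)))) = -Kinv (P₀ (Hst J))) (δB : E) (hδ : P₀ δB = δB) :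
    ⟪δB, Hst J⟫ + ⟪δB, Hst (Δ₁ (H B))⟫ + ⟪δB, Hst (dV (H B))⟫ = 0 :=
  (eq112_iff_eq113 hP2 hPsa H Hst Δ₁ dV J hKl hKr hKP hB).mpr h113 δB hδ

end Literature.MathematicalPhysics.QuantumFieldTheory.Balaban1983to89.B16Eq112
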